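import Summits.QuantumFields.BalabanUV.InfraRed.StrongCouplingSharpCurvature
import Summits.QuantumFields.BalabanUV.InfraRed.StrongCouplingDimensionalWindow

/-!
# Strong-coupling front, J-SC13 (part 3/3): the SHARP one-link Poincaré inequality
`OneLinkPoincareSU2 R (2/3)` for EVERY radius `R` and the hypothesis-free window `β_W < √3/9 = 0.19245`
— observatory of the non-perturbative crossover; no mass-gap claim

IR-3 v2 TWO-FRONT CROSSOVER LEDGER, front SC (`β₀`), SU(2), `d = 4`, Wilson normalisation `β_W = 4/g²`
(`R = 3β_W/2`, `κ = 6β_W`).  observatory of the non-perturbative crossover; no mass-gap claim.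

ABSOLUTE RULE. No internally-minted statement may enter as a cited fact. Every hypothesis is either
kernel-proved in this package or a verbatim quotation of a PUBLISHED theorem with page reference. The
manuscript(s) under audit are NOT citable for their own disputed steps — they are the thing under
adjudication; programme-internal (2001/route/tribunal) claims are never citable.  THIS FILE HAS NO
HYPOTHESES: every statement below is kernel-proved from the tree (parts 1/3–2/3 `StrongCouplingSharpTwist` / `StrongCouplingSharpCurvature`,
J-SC12's `StrongCouplingDimensionalPoincare.poincare_pot_K` / `StrongCouplingDimensionalVariance.var_tilted_le_of_poincare_K`,
J-SC11's doors `StrongCouplingSixFifthsWindow.su2_*_of_threeTenths`, and the tree's Dobrushin / Kotecký–Preiss chain);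
names of published results appear as ATTRIBUTION only.

WHAT THIS FILE PROVES (hypothesis-free):
* `su2_var_tilted_le_sharp`: `Var_{ν_B}(ψ) ≤ M²/(3/2) = (2/3) M²` for EVERY `B ∈ M₂(ℂ)` and every `ψ` with
  `|ψ(a) - ψ(b)| ≤ M ‖a - b‖_F`, `ν_B(dg) ∝ exp(2 Re tr(g B)) dg` — the Haar value of the constant
  (`2/λ₁(S³)` in the tree's units), from part 2's `(3/2) ∫ e^S Γ ≤ ∫ e^S (L_S u)²` through `poincare_pot_K`;
* `oneLinkPoincareSU2_sharp (R) : OneLinkPoincareSU2 R (2/3)` for every `R : ℝ` — in particular the typed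
  target of `StrongCouplingPoincareWindow`, `sharpPoincareSU2 : SharpPoincareSU2` (`= OneLinkPoincareSU2 (1/4) (2/3)`),
  and `OneLinkPoincareSU2 (3/10) (2/3)`, the hypothesis of J-SC11's doors;
* the three ledger doors on the window `0 ≤ β_W < √3/9 = 0.19245…` (equivalently `27 β_W² < 1`), now
  WITHOUT hypothesis: `su2_strongCouplingFront_sharp` (SC-b), `su2_dlrMassGapAt_sharp` (SC-a),
  `su2_latticeMassGap_sharp` (SC-c), their polynomial forms `…_sharp'`, and decimal / integer-coupling
  instances (`β_W = 0.1924`, `g² = 21`).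
OWNED NUMBER of the front moves from J-SC12's `β_W < √(13/696) = 0.13667` to `β_W < √3/9 = 0.19245`
(`g² = 4/β_W > 20.78`), grade (K).  This EXHAUSTS the Poincaré → Kantorovich–Rubinstein route of
`StrongCouplingPoincareWindow`: `2/3` is the Haar value of the constant (no `c < 2/3` can hold at `B = 0`),
so `√3/9` is the supremum of that route's window; the one-link Dobrushin door itself is capped at `2/9 = 0.2222`
(J-SC9).  No statement is made at or beyond these numbers; no mass-gap claim.
-/

noncomputable section

open scoped Matrix ComplexConjugate BigOperators Matrix.Norms.Frobenius ContDiff Topology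
open Matrix Complex Finset MeasureTheory Filter ProbabilityTheory
open Literature.MathematicalPhysics.QuantumFieldTheory
open Literature.MathematicalPhysics.QuantumFieldTheory.SUNBakryEmery

namespace Summit.QuantumFields.BalabanUV.InfraRed.StrongCouplingSharpWindow

open Summit.QuantumFields.BalabanUV.InfraRed.StrongCouplingSharpCurvature
open Summit.QuantumFields.BalabanUV.InfraRed.StrongCouplingDimensionalPoincare
open Summit.QuantumFields.BalabanUV.InfraRed.StrongCouplingDimensionalVariance
open Summit.QuantumFields.BalabanUV.InfraRed.StrongCouplingPoincareWindow
open Summit.QuantumFields.BalabanUV.InfraRed.StrongCouplingSixFifthsWindow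
open Literature.Probability.LatticeModels
open Literature.MathematicalPhysics.QuantumLattice (fundamentalRep fundamentalLatticeRep)
open Literature.MathematicalPhysics.QuantumFieldTheory.Balaban1983to89
open Literature.MathematicalPhysics.QuantumFieldTheory.Balaban1983to89.StrongCouplingDobrushinWindow
open Literature.MathematicalPhysics.QuantumFieldTheory.Balaban1983to89.StrongCouplingTorusWindow
open Literature.MathematicalPhysics.QuantumFieldTheory.Balaban1983to89.StrongCouplingKernelWindow
open Literature.MathematicalPhysics.QuantumFieldTheory.Balaban1983to89.StrongCouplingOpenWindow

/-! ## Part A: the variance bound with the Haar constant, every `B` -/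

/-- **The sharp one-link variance bound on `SU(2)`** (hypothesis-free): for EVERY `B ∈ M₂(ℂ)` and `ψ` with
`|ψ(a) - ψ(b)| ≤ M‖a - b‖_F`, `Var_{ν_B}(ψ) ≤ M²/(3/2)`, `ν_B(dg) ∝ exp(2 Re tr(g B)) dg` — the Haar value
`3/2` of the Poincaré constant in the tree's units (part 2's `integral_exp_mul_Gam_le_sharp` fed into
`poincare_pot_K` and `var_tilted_le_of_poincare_K`). [folklore] -/
theorem su2_var_tilted_le_sharp (B : Matrix (Fin 2) (Fin 2) ℂ)
    (ψ : Matrix.specialUnitaryGroup (Fin 2) ℂ → ℝ) (M : ℝ) (hM : 0 ≤ M)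
    (hψ : ∀ a b, |ψ a - ψ b| ≤ M * suFrobDist a b) :
    Var[ψ; (haarProbability (Matrix.specialUnitaryGroup (Fin 2) ℂ)).tilted
        fun g => (2 : ℝ) * ((g : Matrix (Fin 2) (Fin 2) ℂ) * B).trace.re] ≤ M ^ 2 / (3 / 2) := by
  have hKpos : (0 : ℝ) < 3 / 2 := by norm_num
  have hGam : ∀ {v : Matrix (Fin 2) (Fin 2) ℂ → ℝ}, ContDiff ℝ ∞ v →
      (3 / 2) * ∫ g : SUN 2, Real.exp (pot (2 : ℝ) B g) * Gam v v g ∂(haarSU 2) ≤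
        ∫ g : SUN 2, Real.exp (pot (2 : ℝ) B g) * genL (pot (2 : ℝ) B) v g ^ 2 ∂(haarSU 2) :=
    fun hv => integral_exp_mul_Gam_le_sharp (2 : ℝ) B hv
  have h2 : ((2 : ℕ) : ℝ) = 2 := by norm_num
  have hP : ∀ {F : Matrix (Fin 2) (Fin 2) ℂ → ℝ}, ContDiff ℝ ∞ F →
      (3 / 2) * ∫ g : SUN 2, Real.exp (pot ((2 : ℕ) : ℝ) B g) * (F g -
          (∫ g : SUN 2, Real.exp (pot ((2 : ℕ) : ℝ) B g) * F g ∂(haarSU 2)) /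
            (∫ g : SUN 2, Real.exp (pot ((2 : ℕ) : ℝ) B g) ∂(haarSU 2))) ^ 2 ∂(haarSU 2) ≤
        ∫ g : SUN 2, Real.exp (pot ((2 : ℕ) : ℝ) B g) * Gam F F g ∂(haarSU 2) := by
    rw [h2]
    intro F hF
    exact poincare_pot_K two_ne_zero (2 : ℝ) B hKpos hGam hF
  have hvar := var_tilted_le_of_poincare_K (N := 2) two_ne_zero B hKpos hP ψ M hM hψ
  rw [h2] at hvar
  exact hvar

/-! ## Part B: the sharp one-link Poincaré inequality, every radius -/

/-- **The sharp one-link Poincaré inequality on `SU(2)`** (hypothesis-free): `OneLinkPoincareSU2 R (2/3)` for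
EVERY `R : ℝ` — tilting Haar measure on `SU(2) ≅ S³` by `exp(2 Re tr(g B))` never lowers the Poincaré
constant below its Haar value, whatever `B ∈ M₂(ℂ)`.  (Bakry–Émery gives `1/(1 - 2R)` on `R < 1/2` only,
J-SC12's dimensional constant `112/(117 - 768R²)` on `R < 0.39` only.) [folklore] -/
theorem oneLinkPoincareSU2_sharp (R : ℝ) : OneLinkPoincareSU2 R (2 / 3) := by
  intro B _ ψ M hM hψ
  calc Var[ψ; (haarProbability (Matrix.specialUnitaryGroup (Fin 2) ℂ)).tilted
          (Literature.MathematicalPhysics.QuantumFieldTheory.Balaban1983to89.StrongCouplingVarianceWindow.pot B)]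
        ≤ M ^ 2 / (3 / 2) := su2_var_tilted_le_sharp B ψ M hM hψ
    _ = 2 / 3 * M ^ 2 := by ring

/-- **The typed target `SharpPoincareSU2` of `StrongCouplingPoincareWindow` holds** (hypothesis-free):
`OneLinkPoincareSU2 (1/4) (2/3)`. [folklore] -/
theorem sharpPoincareSU2 : SharpPoincareSU2 :=
  oneLinkPoincareSU2_sharp (1 / 4)

/-- The hypothesis of J-SC11's doors holds (hypothesis-free): `OneLinkPoincareSU2 (3/10) (2/3)`. [folklore] -/
theorem oneLinkPoincareSU2_threeTenths_sharp : OneLinkPoincareSU2 (3 / 10) (2 / 3) :=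
  oneLinkPoincareSU2_sharp (3 / 10)

/-- **The sharp one-link KR modulus** (hypothesis-free): `OneLinkKRModulusSU2 β_W (√(4/3)/4)`
(`K₂ = 1/(2√3) = 0.2887`) for every `β_W ≤ 1/5`. [folklore] -/
theorem oneLinkKRModulusSU2_sharp {βW : ℝ} (h5 : βW ≤ 1 / 5) : OneLinkKRModulusSU2 βW (Real.sqrt (4 / 3) / 4) :=
  oneLinkKRModulusSU2_of_threeTenths oneLinkPoincareSU2_threeTenths_sharp h5

/-! ## Part C: the window `β_W < √3/9` and the ledger doors (hypothesis-free) -/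

/-- The window in polynomial form: for `0 ≤ β_W`, `β_W < √3/9 ↔ 27 β_W² < 1`. [folklore] -/
theorem su2_window_sharp_iff {βW : ℝ} (h0 : 0 ≤ βW) : βW < Real.sqrt 3 / 9 ↔ 27 * βW ^ 2 < 1 := by
  rw [← su2_sharpPoincare_window_iff h0]
  have e : (4 : ℝ) / 3 = 2 * (2 / 3) := by norm_num
  rw [e, su2_window_iff_of_poincare h0 (by norm_num)]
  constructor <;> intro h <;> linarith

/-- **SC-b, sharp window** (hypothesis-free): `0 ≤ β₀W → β₀W < √3/9 →
StrongCouplingFront (fundamentalLatticeRep 2) (β₀W/2)` — volume-uniform clustering of Wilson loops on every torus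
`(ℤ/Lℤ)⁴` at every Wilson coupling `≤ β₀W`, for every `β₀W < 0.19245` (`g² > 20.78`); past J-SC12's `0.13667`.
[folklore] -/
theorem su2_strongCouplingFront_sharp {β₀W : ℝ} (h0 : 0 ≤ β₀W) (hlt : β₀W < Real.sqrt 3 / 9) :
    CrossoverLedger.StrongCouplingFront (fundamentalLatticeRep 2) (β₀W / 2) :=
  su2_strongCouplingFront_of_threeTenths oneLinkPoincareSU2_threeTenths_sharp h0 hlt

/-- **SC-a, sharp window** (hypothesis-free): `0 ≤ βW → βW < √3/9 → DLRMassGapAt 4 2 (βW/4)` — unique Gibbs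
measure and exponential clustering of the `SU(2)` Wilson DLR specification on `ℤ⁴`. [folklore] -/
theorem su2_dlrMassGapAt_sharp {βW : ℝ} (h0 : 0 ≤ βW) (hlt : βW < Real.sqrt 3 / 9) : DLRMassGapAt 4 2 (βW / 4) :=
  su2_dlrMassGapAt_of_threeTenths oneLinkPoincareSU2_threeTenths_sharp h0 hlt

/-- **SC-c, sharp window** (hypothesis-free): `0 ≤ βW → βW < √3/9 →
LatticeMassGap (fundamentalRep (Fin 2)) (βW/2) (krRate (18 βW √(4/3)/4))`. [folklore] -/
theorem su2_latticeMassGap_sharp {βW : ℝ} (h0 : 0 ≤ βW) (hlt : βW < Real.sqrt 3 / 9) :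
    CrossoverLedger.LatticeMassGap (fundamentalRep (Fin 2)) (βW / 2) (krRate (18 * βW * (Real.sqrt (4 / 3) / 4))) :=
  su2_latticeMassGap_of_threeTenths oneLinkPoincareSU2_threeTenths_sharp h0 hlt

/-- SC-b, sharp window, polynomial form: `0 ≤ β₀W → 27 β₀W² < 1 → StrongCouplingFront (fundamentalLatticeRep 2) (β₀W/2)`.
[folklore] -/
theorem su2_strongCouplingFront_sharp' {β₀W : ℝ} (h0 : 0 ≤ β₀W) (hw : 27 * β₀W ^ 2 < 1) :
    CrossoverLedger.StrongCouplingFront (fundamentalLatticeRep 2) (β₀W / 2) :=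
  su2_strongCouplingFront_sharp h0 ((su2_window_sharp_iff h0).2 hw)

/-- SC-a, sharp window, polynomial form: `0 ≤ βW → 27 βW² < 1 → DLRMassGapAt 4 2 (βW/4)`. [folklore] -/
theorem su2_dlrMassGapAt_sharp' {βW : ℝ} (h0 : 0 ≤ βW) (hw : 27 * βW ^ 2 < 1) : DLRMassGapAt 4 2 (βW / 4) :=
  su2_dlrMassGapAt_sharp h0 ((su2_window_sharp_iff h0).2 hw)

/-- SC-c, sharp window, polynomial form. [folklore] -/
theorem su2_latticeMassGap_sharp' {βW : ℝ} (h0 : 0 ≤ βW) (hw : 27 * βW ^ 2 < 1) :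
    CrossoverLedger.LatticeMassGap (fundamentalRep (Fin 2)) (βW / 2) (krRate (18 * βW * (Real.sqrt (4 / 3) / 4))) :=
  su2_latticeMassGap_sharp h0 ((su2_window_sharp_iff h0).2 hw)

/-! ## Part D: decimal and integer-coupling headline instances (hypothesis-free) -/

/-- SC-b at `β₀W = 0.1924` (`27 · 0.1924² = 0.9995 < 1`; `g² = 4/β₀W = 20.79`). [folklore] -/
theorem su2_strongCouplingFront_01924 : CrossoverLedger.StrongCouplingFront (fundamentalLatticeRep 2) ((0.1924 : ℝ) / 2) :=
  su2_strongCouplingFront_sharp' (by norm_num) (by norm_num)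

/-- SC-a at `βW = 0.1924`. [folklore] -/
theorem su2_dlrMassGapAt_01924 : DLRMassGapAt 4 2 ((0.1924 : ℝ) / 4) :=
  su2_dlrMassGapAt_sharp' (by norm_num) (by norm_num)

/-- SC-c at `βW = 0.1924`. [folklore] -/
theorem su2_latticeMassGap_01924 : CrossoverLedger.LatticeMassGap (fundamentalRep (Fin 2)) ((0.1924 : ℝ) / 2)
    (krRate (18 * (0.1924 : ℝ) * (Real.sqrt (4 / 3) / 4))) :=
  su2_latticeMassGap_sharp' (by norm_num) (by norm_num)

/-- SC-b at the integer bare coupling `g² = 21`, i.e. `β₀W = 4/21 = 0.19048` (`27 · 16/441 = 432/441 < 1`) —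
every integer `g² ≥ 21` lies in the certified strong-coupling window. [folklore] -/
theorem su2_strongCouplingFront_four_div_twentyone :
    CrossoverLedger.StrongCouplingFront (fundamentalLatticeRep 2) ((4 / 21 : ℝ) / 2) :=
  su2_strongCouplingFront_sharp' (by norm_num) (by norm_num)

/-- SC-a at `g² = 21` (`βW = 4/21`). [folklore] -/
theorem su2_dlrMassGapAt_four_div_twentyone : DLRMassGapAt 4 2 ((4 / 21 : ℝ) / 4) :=
  su2_dlrMassGapAt_sharp' (by norm_num) (by norm_num)

end Summit.QuantumFields.BalabanUV.InfraRed.StrongCouplingSharpWindow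

end
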